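import Literature.NumberTheory.Irrationality.Tosi2026.SechChainCoordinates
import Mathlib.MeasureTheory.Measure.Lebesgue.EqHaar
import HarnessLib

/-!
# The cyclic symmetry of the pinned `sech`-cycle: `∫_{(0,∞)^{n+1}} Ψ = (1/(n+2)) ∫_{ℝ^{n+1}} Ψ`

Second part of our proof of R. Tosi, *An explicit study of a family of cellular integrals*,
arXiv:2601.00346 [Tosi2026], Theorem 1 (typed as `Tosi2026.theorem1`). After the substitution
`x = tanh a` (`SechChainCoordinates.lean`) the integrand of `ξ_{n+1}` is

`Ψ(a) = sech(a₀) ∏_{i<n} sech(a_i − a_{i+1}) sech(a_n) = ∏_{m ∈ ℤ/(n+2)} sech(â_m − â_{m+1})`,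

the product of `sech` over the EDGES OF AN `(n+2)`-CYCLE whose vertices carry `â = (0, a₀, …, a_n)`
(`pin`, `cycleDensity_eq_prod_pin`). The linear map

`T a = (a₁ − a₀, a₂ − a₀, …, a_n − a₀, −a₀)`   (`cycleShift`; on `â` it is "rotate the cycle and
re-pin the new first vertex at `0`", `pin_cycleShift`)

has order `n+2` (`cycleShift_pow`), hence `|det T| = 1` and `T` preserves Lebesgue measure
(`measurePreserving_cycleShift`); it preserves `Ψ` (`cycleDensity_cycleShift`); and it permutes
cyclically the `n+2` regions `R_k = {â_k is the strict minimum of â}` (`minRegion`,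
`preimage_cycleShift_minRegion`), which are disjoint, cover `ℝ^{n+1}` up to a null set, and of which
`R₀` is the positive orthant. Hence all `∫_{R_k} Ψ` are equal and

`∫_{ℝ^{n+1}} Ψ = (n+2) · ∫_{(0,∞)^{n+1}} Ψ`   (`lintegral_cycleDensity_eq_mul_posOrthant`).

This symmetry is the dihedral symmetry of the cellular form in the coordinates `â`; it explains at
once the closed form of `ξ_l` for all `l` and the relation between odd and even `l` that [Tosi2026]
observes (its §3 sketches an explanation "in the spirit of Grothendieck's Period Conjecture").
All statements here are proved; no named facts.
-/

noncomputable section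

open MeasureTheory Set Finset Real Function
open scoped ENNReal
open Literature.Analysis.SpecialFunctions

namespace Literature.NumberTheory.Irrationality.Tosi2026

open Fin.CommRing

/-! ### The pinned cycle `â = (0, a₀, …, a_n)` -/

/-- `pin a = (0, a₀, …, a_n) ∈ ℝ^{n+2}`: the values on the vertices of the `(n+2)`-cycle, vertex `0`
pinned at `0`. [cite: Tosi2026, Theorem 1 (proof device, ours)] -/
def pin (n : ℕ) (a : Fin (n + 1) → ℝ) : Fin (n + 2) → ℝ := Fin.cons 0 a

/-- `â₀ = 0`. [cite: Tosi2026, Theorem 1 (proof device, ours)] -/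
@[simp] theorem pin_zero (n : ℕ) (a : Fin (n + 1) → ℝ) : pin n a 0 = 0 := by
  simp [pin]

/-- `â_{i+1} = a_i`. [cite: Tosi2026, Theorem 1 (proof device, ours)] -/
@[simp] theorem pin_succ (n : ℕ) (a : Fin (n + 1) → ℝ) (i : Fin (n + 1)) : pin n a i.succ = a i := by
  simp [pin]

/-- `â₁ = a₀`. [cite: Tosi2026, Theorem 1 (proof device, ours)] -/
@[simp] theorem pin_one (n : ℕ) (a : Fin (n + 1) → ℝ) : pin n a 1 = a 0 := by
  rw [← Fin.succ_zero_eq_one, pin_succ]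

/-- `pin` is additive. [cite: Tosi2026, Theorem 1 (proof device, ours)] -/
theorem pin_add (n : ℕ) (a b : Fin (n + 1) → ℝ) : pin n (a + b) = pin n a + pin n b := by
  funext m
  refine Fin.cases ?_ (fun i => ?_) m
  · simp
  · simp

/-- `pin` is homogeneous. [cite: Tosi2026, Theorem 1 (proof device, ours)] -/
theorem pin_smul (n : ℕ) (c : ℝ) (a : Fin (n + 1) → ℝ) : pin n (c • a) = c • pin n a := by
  funext m
  refine Fin.cases ?_ (fun i => ?_) m
  · simp
  · simp

/-- In `Fin (n+2)`: `(j+1) + 1 = j+2` for `j < n` (no wrap-around). [cite: Tosi2026, Theorem 1 (proof device, ours)] -/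
theorem castSucc_succ_add_one {n : ℕ} (j : Fin n) : (j.castSucc.succ : Fin (n + 2)) + 1 = j.succ.succ := by
  ext
  rw [Fin.val_add_one_of_lt (by simp only [Fin.lt_def, Fin.val_succ, Fin.val_castSucc, Fin.val_last]; omega)]
  simp

/-- **The integrand is the product of `sech` over the edges of the pinned `(n+2)`-cycle**:
`Ψ(a) = ∏_{m} sech(â_m − â_{m+1})` (indices mod `n+2`). [cite: Tosi2026, Theorem 1 (proof device, ours)] -/
theorem cycleDensity_eq_prod_pin (n : ℕ) (a : Fin (n + 1) → ℝ) :
    cycleDensity n a = ∏ m : Fin (n + 2), sech (pin n a m - pin n a (m + 1)) := by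
  rw [Fin.prod_univ_succ, Fin.prod_univ_castSucc]
  have h0 : sech (pin n a 0 - pin n a (0 + 1)) = sech (a 0) := by
    rw [zero_add, pin_zero, pin_one, zero_sub, sech_neg]
  have hmid : ∀ j : Fin n, sech (pin n a j.castSucc.succ - pin n a (j.castSucc.succ + 1)) =
      sech (a j.castSucc - a j.succ) := by
    intro j; rw [castSucc_succ_add_one, pin_succ, pin_succ]
  have hlast : sech (pin n a (Fin.last n).succ - pin n a ((Fin.last n).succ + 1)) = sech (a (Fin.last n)) := by
    rw [Fin.succ_last, Fin.last_add_one, pin_zero, sub_zero, ← Fin.succ_last, pin_succ]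
  rw [h0, prod_congr rfl fun j _ => hmid j, hlast]
  unfold cycleDensity chainDensity
  ring

/-! ### The rotation `T` -/

/-- `σ(v)_m = v_{m+1} − v_1`: rotate the cycle by one step and re-pin the new first vertex at `0`.
[cite: Tosi2026, Theorem 1 (proof device, ours)] -/
def rotSub (n : ℕ) (v : Fin (n + 2) → ℝ) : Fin (n + 2) → ℝ := fun m => v (m + 1) - v 1

/-- **The cyclic shift** `T a = (a₁ − a₀, …, a_n − a₀, −a₀)` as a linear map of `ℝ^{n+1}`.
[cite: Tosi2026, Theorem 1 (proof device, ours)] -/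
def cycleShift (n : ℕ) : (Fin (n + 1) → ℝ) →ₗ[ℝ] (Fin (n + 1) → ℝ) where
  toFun a := fun i => pin n a (i.succ + 1) - a 0
  map_add' a b := by
    funext i
    simp only [pin_add, Pi.add_apply]
    ring
  map_smul' c a := by
    funext i
    simp only [pin_smul, Pi.smul_apply, smul_eq_mul, RingHom.id_apply]
    ring

/-- `(T a)_i = â_{i+2} − a₀`. [cite: Tosi2026, Theorem 1 (proof device, ours)] -/
theorem cycleShift_apply (n : ℕ) (a : Fin (n + 1) → ℝ) (i : Fin (n + 1)) :
    cycleShift n a i = pin n a (i.succ + 1) - a 0 := rfl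

/-- **`T` on the pinned cycle is the rotation `σ`**: `pin (T a) = σ (pin a)`.
[cite: Tosi2026, Theorem 1 (proof device, ours)] -/
theorem pin_cycleShift (n : ℕ) (a : Fin (n + 1) → ℝ) : pin n (cycleShift n a) = rotSub n (pin n a) := by
  funext m
  refine Fin.cases ?_ (fun i => ?_) m
  · simp [rotSub]
  · rw [pin_succ, cycleShift_apply, rotSub, pin_one]

/-- The iterates of `σ`: `σ^{j+1}(v)_m = v_{m+j+1} − v_{j+1}`. [cite: Tosi2026, Theorem 1 (proof device, ours)] -/
theorem rotSub_iterate (n : ℕ) (v : Fin (n + 2) → ℝ) :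
    ∀ (j : ℕ) (m : Fin (n + 2)),
      (rotSub n)^[j + 1] v m = v (m + ((j + 1 : ℕ) : Fin (n + 2))) - v ((j + 1 : ℕ) : Fin (n + 2))
  | 0, m => by simp [rotSub]
  | j + 1, m => by
      rw [iterate_succ_apply', rotSub, rotSub_iterate n v j, rotSub_iterate n v j]
      have e1 : m + 1 + ((j + 1 : ℕ) : Fin (n + 2)) = m + ((j + 1 + 1 : ℕ) : Fin (n + 2)) := by
        push_cast; ring
      have e2 : (1 : Fin (n + 2)) + ((j + 1 : ℕ) : Fin (n + 2)) = ((j + 1 + 1 : ℕ) : Fin (n + 2)) := by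
        push_cast; ring
      rw [e1, e2]
      ring

/-- `σ^{n+2} v = v` when `v₀ = 0`. [cite: Tosi2026, Theorem 1 (proof device, ours)] -/
theorem rotSub_iterate_order (n : ℕ) (v : Fin (n + 2) → ℝ) (hv : v 0 = 0) :
    (rotSub n)^[n + 2] v = v := by
  funext m
  rw [rotSub_iterate n v (n + 1) m]
  have : ((n + 1 + 1 : ℕ) : Fin (n + 2)) = 0 := Fin.natCast_self (n + 2)
  rw [this, add_zero, hv, sub_zero]

/-- `pin` is injective. [cite: Tosi2026, Theorem 1 (proof device, ours)] -/
theorem pin_injective (n : ℕ) : Function.Injective (pin n) := by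
  intro a b h
  funext i
  have := congr_fun h i.succ
  simpa using this

/-- **`T` has order `n+2`** (as iterates). [cite: Tosi2026, Theorem 1 (proof device, ours)] -/
theorem cycleShift_iterate (n : ℕ) (a : Fin (n + 1) → ℝ) : (cycleShift n)^[n + 2] a = a := by
  have hsemi : Function.Semiconj (pin n) (cycleShift n) (rotSub n) := fun a => pin_cycleShift n a
  have h := (hsemi.iterate_right (n + 2)).eq a
  rw [rotSub_iterate_order n (pin n a) (pin_zero n a)] at h
  exact pin_injective n h

/-- **`T^{n+2} = 1`** in `End(ℝ^{n+1})`. [cite: Tosi2026, Theorem 1 (proof device, ours)] -/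
theorem cycleShift_pow (n : ℕ) : cycleShift n ^ (n + 2) = 1 := by
  refine LinearMap.ext fun a => ?_
  rw [Module.End.pow_apply, cycleShift_iterate]
  rfl

/-- **`|det T| = 1`**. [cite: Tosi2026, Theorem 1 (proof device, ours)] -/
theorem abs_det_cycleShift (n : ℕ) : |LinearMap.det (cycleShift n)| = 1 := by
  have h := congrArg LinearMap.det (cycleShift_pow n)
  rw [map_pow, map_one] at h
  have h' : |LinearMap.det (cycleShift n)| ^ (n + 2) = 1 := by rw [← abs_pow, h, abs_one]
  exact (pow_eq_one_iff_of_nonneg (abs_nonneg _) (by omega)).mp h'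

/-- **`T` preserves Lebesgue measure** (`|det T| = 1`). [cite: Tosi2026, Theorem 1 (proof device, ours)] -/
theorem measurePreserving_cycleShift (n : ℕ) :
    MeasurePreserving (cycleShift n) (volume : Measure (Fin (n + 1) → ℝ)) volume := by
  refine ⟨(cycleShift n).continuous_of_finiteDimensional.measurable, ?_⟩
  have hdet : LinearMap.det (cycleShift n) ≠ 0 := by
    intro h
    have h1 := abs_det_cycleShift n
    rw [h, abs_zero] at h1
    exact zero_ne_one h1
  rw [Measure.map_linearMap_addHaar_eq_smul_addHaar volume hdet, abs_inv, abs_det_cycleShift, inv_one,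
    ENNReal.ofReal_one, one_smul]

/-- **`T` preserves the integrand**: `Ψ(T a) = Ψ(a)` (the edge set of the cycle is rotation invariant).
[cite: Tosi2026, Theorem 1 (proof device, ours)] -/
theorem cycleDensity_cycleShift (n : ℕ) (a : Fin (n + 1) → ℝ) :
    cycleDensity n (cycleShift n a) = cycleDensity n a := by
  rw [cycleDensity_eq_prod_pin, cycleDensity_eq_prod_pin, pin_cycleShift]
  have hterm : ∀ m : Fin (n + 2), sech (rotSub n (pin n a) m - rotSub n (pin n a) (m + 1)) =
      sech (pin n a (m + 1) - pin n a (m + 1 + 1)) := by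
    intro m; simp only [rotSub]; ring_nf
  rw [prod_congr rfl fun m _ => hterm m]
  exact Fintype.prod_equiv (Equiv.addRight 1) _ _ fun m => rfl

/-! ### The regions `R_k = {â_k is the strict minimum}` -/

/-- `R_k = {a | â_k < â_m for all m ≠ k}`. [cite: Tosi2026, Theorem 1 (proof device, ours)] -/
def minRegion (n : ℕ) (k : Fin (n + 2)) : Set (Fin (n + 1) → ℝ) :=
  {a | ∀ m, m ≠ k → pin n a k < pin n a m}

/-- `R₀` is the positive orthant. [cite: Tosi2026, Theorem 1 (proof device, ours)] -/
theorem minRegion_zero (n : ℕ) : minRegion n 0 = posOrthant n := by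
  ext a
  simp only [minRegion, posOrthant, mem_setOf_eq, pin_zero]
  constructor
  · intro h i
    have := h i.succ (Fin.succ_ne_zero i)
    simpa using this
  · intro h m hm
    obtain ⟨i, rfl⟩ := Fin.exists_succ_eq.mpr hm
    simpa using h i

/-- `a ↦ â_m` is measurable. [cite: Tosi2026, Theorem 1 (proof device, ours)] -/
theorem measurable_pin_apply (n : ℕ) (m : Fin (n + 2)) : Measurable fun a : Fin (n + 1) → ℝ => pin n a m := by
  refine Fin.cases ?_ (fun i => ?_) m
  · simp only [pin_zero]; exact measurable_const
  · simp only [pin_succ]; exact measurable_pi_apply i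

/-- `R_k` is measurable. [cite: Tosi2026, Theorem 1 (proof device, ours)] -/
theorem measurableSet_minRegion (n : ℕ) (k : Fin (n + 2)) : MeasurableSet (minRegion n k) := by
  have e : minRegion n k = ⋂ m : Fin (n + 2), {a | m ≠ k → pin n a k < pin n a m} := by
    ext a; simp [minRegion]
  rw [e]
  refine MeasurableSet.iInter fun m => ?_
  by_cases hm : m = k
  · have : {a : Fin (n + 1) → ℝ | m ≠ k → pin n a k < pin n a m} = univ := by
      ext a; simp [hm]
    rw [this]; exact MeasurableSet.univ
  · have : {a : Fin (n + 1) → ℝ | m ≠ k → pin n a k < pin n a m} = {a | pin n a k < pin n a m} := by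
      ext a; simp [hm]
    rw [this]
    exact measurableSet_lt (measurable_pin_apply n k) (measurable_pin_apply n m)

/-- The regions are pairwise disjoint. [cite: Tosi2026, Theorem 1 (proof device, ours)] -/
theorem disjoint_minRegion (n : ℕ) : Pairwise (Disjoint on minRegion n) := by
  intro k l hkl
  rw [Function.onFun, Set.disjoint_left]
  intro a hk hl
  exact lt_asymm (hk l hkl.symm) (hl k hkl)

/-- **`T` rotates the regions**: `T⁻¹(R_k) = R_{k+1}`. [cite: Tosi2026, Theorem 1 (proof device, ours)] -/
theorem preimage_cycleShift_minRegion (n : ℕ) (k : Fin (n + 2)) :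
    cycleShift n ⁻¹' minRegion n k = minRegion n (k + 1) := by
  ext a
  simp only [Set.mem_preimage, minRegion, mem_setOf_eq, pin_cycleShift, rotSub, sub_lt_sub_iff_right]
  constructor
  · intro h m hm
    have h1 := h (m - 1) (fun e => hm (by rw [← e, sub_add_cancel]))
    rwa [sub_add_cancel] at h1
  · intro h m hm
    exact h (m + 1) (fun e => hm (add_right_cancel e))

/-! ### The complement of the regions is null -/

/-- `a ↦ â_m` as a linear functional. [cite: Tosi2026, Theorem 1 (proof device, ours)] -/
def pinLinear (n : ℕ) (m : Fin (n + 2)) : (Fin (n + 1) → ℝ) →ₗ[ℝ] ℝ where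
  toFun a := pin n a m
  map_add' a b := by rw [pin_add]; rfl
  map_smul' c a := by rw [pin_smul]; rfl

/-- Off the regions two vertex values coincide. [cite: Tosi2026, Theorem 1 (proof device, ours)] -/
theorem exists_pin_eq_of_not_mem (n : ℕ) {a : Fin (n + 1) → ℝ} (ha : ∀ k, a ∉ minRegion n k) :
    ∃ p q : Fin (n + 2), p ≠ q ∧ pin n a p = pin n a q := by
  obtain ⟨k, -, hk⟩ := exists_min_image univ (fun m => pin n a m) univ_nonempty
  have hk' := ha k
  simp only [minRegion, mem_setOf_eq, not_forall, not_lt] at hk'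
  obtain ⟨m, hm, hle⟩ := hk'
  exact ⟨k, m, fun e => hm e.symm, le_antisymm (hk m (mem_univ _)) hle⟩

/-- The coincidence set `{â_p = â_q}` (`p ≠ q`) is Lebesgue-null (a proper linear subspace).
[cite: Tosi2026, Theorem 1 (proof device, ours)] -/
theorem volume_pin_eq_pin (n : ℕ) {p q : Fin (n + 2)} (hpq : p ≠ q) :
    volume {a : Fin (n + 1) → ℝ | pin n a p = pin n a q} = 0 := by
  set S : Submodule ℝ (Fin (n + 1) → ℝ) := LinearMap.ker (pinLinear n p - pinLinear n q) with hS
  have hset : {a : Fin (n + 1) → ℝ | pin n a p = pin n a q} = (S : Set (Fin (n + 1) → ℝ)) := by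
    ext a
    simp only [mem_setOf_eq, hS, SetLike.mem_coe, LinearMap.mem_ker, LinearMap.sub_apply, sub_eq_zero]
    rfl
  rw [hset]
  refine Measure.addHaar_submodule volume S ?_
  -- `S ≠ ⊤`: exhibit a vector with `â_p ≠ â_q`
  intro htop
  have key : ∀ a : Fin (n + 1) → ℝ, pin n a p = pin n a q := by
    intro a
    have ha : a ∈ S := by rw [htop]; exact Submodule.mem_top
    rw [hS, LinearMap.mem_ker, LinearMap.sub_apply, sub_eq_zero] at ha
    exact ha
  rcases Fin.eq_zero_or_eq_succ p with hp | ⟨i, hi⟩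
  · -- `p = 0`, `q = j+1`: the constant vector `1`
    subst hp
    obtain ⟨j, rfl⟩ := Fin.exists_succ_eq.mpr hpq.symm
    have := key fun _ => 1
    simp at this
  · subst hi
    have := key (Pi.single i 1)
    rcases Fin.eq_zero_or_eq_succ q with hq | ⟨j, hj⟩
    · subst hq; simp at this
    · subst hj
      have hij : j ≠ i := fun e => hpq (by rw [e])
      simp [hij] at this

/-- **The regions cover `ℝ^{n+1}` up to a null set.** [cite: Tosi2026, Theorem 1 (proof device, ours)] -/
theorem iUnion_minRegion_ae_eq_univ (n : ℕ) :
    (⋃ k, minRegion n k) =ᵐ[(volume : Measure (Fin (n + 1) → ℝ))] univ := by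
  rw [ae_eq_univ]
  have hsub : (⋃ k, minRegion n k)ᶜ ⊆
      ⋃ pq : Fin (n + 2) × Fin (n + 2), {a | pq.1 ≠ pq.2 ∧ pin n a pq.1 = pin n a pq.2} := by
    intro a ha
    simp only [mem_compl_iff, mem_iUnion, not_exists] at ha
    obtain ⟨p, q, hpq, he⟩ := exists_pin_eq_of_not_mem n ha
    exact mem_iUnion.mpr ⟨(p, q), hpq, he⟩
  refine measure_mono_null hsub (measure_iUnion_null fun pq => ?_)
  by_cases h : pq.1 = pq.2
  · have : {a : Fin (n + 1) → ℝ | pq.1 ≠ pq.2 ∧ pin n a pq.1 = pin n a pq.2} = ∅ := by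
      ext a; simp [h]
    rw [this]; exact measure_empty
  · have : {a : Fin (n + 1) → ℝ | pq.1 ≠ pq.2 ∧ pin n a pq.1 = pin n a pq.2} =
        {a | pin n a pq.1 = pin n a pq.2} := by
      ext a; simp [h]
    rw [this]; exact volume_pin_eq_pin n h

/-! ### Equality of the `n+2` pieces and the factor `1/(n+2)` -/

/-- All pieces carry the same mass: `∫_{R_{k+1}} Ψ = ∫_{R_k} Ψ`. [cite: Tosi2026, Theorem 1 (proof device, ours)] -/
theorem setLIntegral_minRegion_add_one (n : ℕ) (k : Fin (n + 2)) :
    ∫⁻ a in minRegion n (k + 1), ENNReal.ofReal (cycleDensity n a) =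
      ∫⁻ a in minRegion n k, ENNReal.ofReal (cycleDensity n a) := by
  rw [← preimage_cycleShift_minRegion]
  have h := (measurePreserving_cycleShift n).setLIntegral_comp_preimage (measurableSet_minRegion n k)
    (f := fun a => ENNReal.ofReal (cycleDensity n a))
    (ENNReal.measurable_ofReal.comp (measurable_cycleDensity n))
  simp only [cycleDensity_cycleShift] at h
  exact h

/-- Hence `∫_{R_k} Ψ = ∫_{R₀} Ψ` for every `k`. [cite: Tosi2026, Theorem 1 (proof device, ours)] -/
theorem setLIntegral_minRegion_eq (n : ℕ) (k : Fin (n + 2)) :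
    ∫⁻ a in minRegion n k, ENNReal.ofReal (cycleDensity n a) =
      ∫⁻ a in minRegion n 0, ENNReal.ofReal (cycleDensity n a) := by
  have hnat : ∀ j : ℕ, ∫⁻ a in minRegion n (j : Fin (n + 2)), ENNReal.ofReal (cycleDensity n a) =
      ∫⁻ a in minRegion n 0, ENNReal.ofReal (cycleDensity n a) := by
    intro j
    induction j with
    | zero => simp
    | succ j ih => rw [Nat.cast_succ, setLIntegral_minRegion_add_one, ih]
  have hk : k = ((k.val : ℕ) : Fin (n + 2)) := (Fin.cast_val_eq_self k).symm
  rw [hk]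
  exact hnat k.val

/-- **The cyclic symmetry**: `∫_{ℝ^{n+1}} Ψ = (n+2) · ∫_{(0,∞)^{n+1}} Ψ`.
[cite: Tosi2026, Theorem 1 (proof device, ours)] -/
theorem lintegral_cycleDensity_eq_mul_posOrthant (n : ℕ) :
    ∫⁻ a, ENNReal.ofReal (cycleDensity n a) =
      ((n : ℝ≥0∞) + 2) * ∫⁻ a in posOrthant n, ENNReal.ofReal (cycleDensity n a) := by
  rw [← setLIntegral_univ, ← setLIntegral_congr (iUnion_minRegion_ae_eq_univ n),
    lintegral_iUnion (measurableSet_minRegion n) (disjoint_minRegion n), tsum_fintype]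
  simp_rw [setLIntegral_minRegion_eq n, minRegion_zero]
  rw [sum_const, card_univ, Fintype.card_fin, nsmul_eq_mul]
  push_cast
  ring

end Literature.NumberTheory.Irrationality.Tosi2026
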